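import Summits.FinalStateConjecture.FinalStateConjecture.Theses.ExactKerrEnds
import Summits.FinalStateConjecture.FinalStateConjecture.Theorems.PhaseMixingCaptureCaptureSufficesC2SettlingTransport
import Summits.FinalStateConjecture.FinalStateConjecture.Theorems.PhaseMixingCaptureWeakCosmicCensorshipMGHDCompleteNullInfinityInvariant
import Literature.Geometry.Lorentzian.ExactKerrEndTrivialData
import Literature.Geometry.Lorentzian.CompleteDevelopmentMaximal
import Literature.Geometry.Lorentzian.TrivialDataAdmissible
import HarnessLib

/-!
# Crux `ExactKerrEnds.SettlingAlongCensoredKerrEnds` (stmt-FinalStateConjecture-18520) — the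
# HYPOTHESES of the crux are met in the tree, non-degenerately, at the trivial datum

The two dynamical cruxes of route `ExactKerrEnds` (`SettlingAlongCensoredKerrEnds`,
`CensorshipAlongKerrEnds`) quantify over tame curves `F` of admissible data whose members off `0` are
KERR-ENDED (let-bound legend `KerrEnded` = `InitialDataSet.HasExactKerrEnd`,
`InitialDataSet.hasExactKerrEnd_iff`) and, for the settling crux, CENSORED (every maximal vacuum
Cauchy development has complete `𝓘⁺`). The birth refuter recorded these hypotheses as "satisfiable
in kind and almost in tree — Kerr-ended with `M = 0` constructible, not built". This file builds
them: with `hasExactKerrEnd_trivialData` (`Literature/…/ExactKerrEndTrivialData.lean`: the trivial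
datum is Kerr-ended, `M = 0`) and the transport of censoredness along breathing diffeomorphisms,
the breathing curve of the trivial datum is a tame, IMMERSED, INJECTIVE curve of admissible data
through `(ℝ³, δ, 0)` every member of which is Kerr-ended and censored — an instance of the
immersed-injective alternative of both cruxes' hypothesis blocks (and of the conclusion of
`CensorshipAlongKerrEnds`) at a certified datum.

* `censored_comap_iff'`, `censored_breatheFamily` — CENSORED (without the `∃ MGHD` conjunct of
  `VacuumCauchyDevelopment.censored_comap_iff`) is invariant under re-indexing by a diffeomorphism,
  in particular constant along breathing curves;
* `censored_trivialData` — every MGHD of the trivial datum has complete `𝓘⁺` (it is isometric to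
  Minkowski space, `Minkowski.isIsometricTo_vacuumCauchyDevelopment_of_isMaximal`, whose `𝓘⁺` is
  complete, `minkowski_hasCompleteNullInfinity`; complete `𝓘⁺` is an isometry invariant);
* `kerrEndedCensoredCurve_trivialData` — the breathing curve of the trivial datum: tame, immersed
  at `0`, injective, admissible, Kerr-ended (`HasExactKerrEnd.breatheFamily`) and censored members;
* `hypothesesWitness_trivialData` — the same in the VERBATIM vocabulary of the route file (the
  let-bound `KerrEnded` / `Censored` at `X = Minkowski.slice`): registered anti-vacuity stub of the
  crux.

No dynamics is claimed. References: Christodoulou, CQG 16 (1999) A23, pp. A24, A26–A27;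
Choquet-Bruhat–Geroch, CMP 14 (1969), Thm. 3; Cook, Living Rev. Relativ. 3 (2000), §3.2.2.
-/

set_option linter.dupNamespace false

noncomputable section

open Set Function Filter TopologicalSpace
open scoped Manifold ContDiff Topology

namespace Summit.FinalStateConjecture.FinalStateConjecture.Theorems.ExactKerrEnds

open Literature.Geometry.Lorentzian
open Summit.FinalStateConjecture (HasCompleteNullInfinity)
open Summit.FinalStateConjecture.FinalStateConjecture.Theorems.PhaseMixingCaptureCaptureSufficesC2
  (injective_mfderiv_homeomorph_symm)
open Summit.FinalStateConjecture.FinalStateConjecture.Theorems.PhaseMixingCapture.WeakCosmicCensorshipMGHD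
  (hasCompleteNullInfinity_iff_of_isIsometricTo)

/-! ### Transport of CENSORED along re-indexing of the datum -/

section Transport

variable {X : Type} [TopologicalSpace X] [ChartedSpace E3 X] [IsManifold (𝓡 3) ∞ X] [ConnectedSpace X]
  {D : InitialDataSet (𝓡 3) X} (Φ : X ≃ₜ X)
  (hΦ : ContMDiff (𝓡 3) (𝓡 3) (∞ + 1) Φ) (hΦ' : ∀ u, Injective (mfderiv (𝓡 3) (𝓡 3) Φ u))

/-- **CENSORED is invariant under re-indexing the datum by a diffeomorphism of `X`**: every
maximal vacuum Cauchy development of `Φ^* D` has complete `𝓘⁺` iff every maximal development of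
`D` does (transfer principle `forall_isMaximal_comap_iff` with
`hasCompleteFutureNullInfinity_precomp_iff`; the form without the `∃ MGHD` conjunct of
`VacuumCauchyDevelopment.censored_comap_iff`). [cite: Christodoulou1999, pp. A26–A27] -/
theorem censored_comap_iff' (hΨ : ContMDiff (𝓡 3) (𝓡 3) (∞ + 1) Φ.symm)
    (hΨ' : ∀ u, Injective (mfderiv (𝓡 3) (𝓡 3) Φ.symm u)) :
    (∀ 𝒟' : VacuumCauchyDevelopment (D.comap Φ hΦ hΦ'), 𝒟'.IsMaximal →
        HasCompleteNullInfinity 𝒟'.toCauchyDevelopment) ↔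
      ∀ 𝒟 : VacuumCauchyDevelopment D, 𝒟.IsMaximal → HasCompleteNullInfinity 𝒟.toCauchyDevelopment :=
  VacuumCauchyDevelopment.forall_isMaximal_comap_iff Φ hΦ hΦ' hΨ hΨ'
    (fun {_} 𝒟 ↦ HasCompleteNullInfinity 𝒟.toCauchyDevelopment)
    fun 𝒟 Θ hΘ hΘ' ↦ 𝒟.hasCompleteFutureNullInfinity_precomp_iff Θ hΘ hΘ'

end Transport

section Breathing

variable {X : Type} [TopologicalSpace X] [ChartedSpace E3 X] [IsManifold (𝓡 3) ∞ X]
  [T2Space X] [ConnectedSpace X]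
  {e : AFEnd X} {z₀ : E3} {r : ℝ} (B : AFEnd.BreathingData e z₀ r) (d : InitialDataSet (𝓡 3) X)

/-- **CENSORED passes from `d` to every member of its breathing family** `(breathe (σ t))^* d`
(`censored_comap_iff'` for the breathing diffeomorphism). [folklore] -/
theorem censored_breatheFamily (t : ℝ)
    (hP : ∀ 𝒟 : VacuumCauchyDevelopment d, 𝒟.IsMaximal → HasCompleteNullInfinity 𝒟.toCauchyDevelopment) :
    ∀ 𝒟 : VacuumCauchyDevelopment (AFEnd.breatheFamily B d t), 𝒟.IsMaximal →
      HasCompleteNullInfinity 𝒟.toCauchyDevelopment := by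
  set Φ : X ≃ₜ X := AFEnd.breatheHomeomorph B (AFEnd.abs_squash_lt_invScale B t) with hΦdef
  have hΦ : ContMDiff (𝓡 3) (𝓡 3) (∞ + 1) Φ :=
    AFEnd.contMDiff_breathe_succ B (AFEnd.abs_squash_lt_scale B t).2
  have hΦ' : ∀ u, Injective (mfderiv (𝓡 3) (𝓡 3) Φ u) :=
    (AFEnd.breatheScale_spec B).2.2 _ (AFEnd.abs_squash_lt_scale B t).1
  have hΨ : ContMDiff (𝓡 3) (𝓡 3) (∞ + 1) Φ.symm := AFEnd.contMDiff_unbreathe B _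
  have hΨ' : ∀ u, Injective (mfderiv (𝓡 3) (𝓡 3) Φ.symm u) :=
    injective_mfderiv_homeomorph_symm Φ hΦ hΨ
  have key : AFEnd.breatheFamily B d t = d.comap Φ hΦ hΦ' := rfl
  rw [key]
  exact (censored_comap_iff' Φ hΦ hΦ' hΨ hΨ').2 hP

end Breathing

/-! ### The trivial datum: censored, Kerr-ended, and its breathing curve -/

/-- **Every maximal vacuum Cauchy development of the trivial datum `(ℝ³, δ, 0)` has complete
future null infinity** — unconditionally: such a development is isometric, as a development, to
Minkowski space (`Minkowski.isIsometricTo_vacuumCauchyDevelopment_of_isMaximal`), whose `𝓘⁺` is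
complete in the sojourn sense (`minkowski_hasCompleteNullInfinity`), and complete `𝓘⁺` is an
invariant of isometric developments (`hasCompleteNullInfinity_iff_of_isIsometricTo`).
[cite: Christodoulou1999, pp. A26–A27] -/
theorem censored_trivialData :
    ∀ 𝒟 : VacuumCauchyDevelopment trivialData, 𝒟.IsMaximal →
      HasCompleteNullInfinity 𝒟.toCauchyDevelopment :=
  fun _ h𝒟 ↦ (hasCompleteNullInfinity_iff_of_isIsometricTo _ _
    (Minkowski.isIsometricTo_vacuumCauchyDevelopment_of_isMaximal h𝒟)).1
      WeakCosmicCensorshipMGHD.Negative.minkowski_hasCompleteNullInfinity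

/-- **The breathing curve of the trivial datum is a tame, immersed, injective curve of admissible,
Kerr-ended, censored data through `(ℝ³, δ, 0)`.** Breathing data: the unit coordinate ball centred
at distance `R + 3` on the sole end `trivialAFEnd` (as in `InitialDataSet.exists_tame_selfWitness`),
the curve read on the collared end `trivialAFEnd.restrict _`; its members are pull-backs of the
trivial datum by compactly supported diffeomorphisms, hence admissible
(`breatheCurve_mem_admissibleVacuumData`), Kerr-ended (`hasExactKerrEnd_trivialData`,
`HasExactKerrEnd.breatheFamily`) and censored (`censored_trivialData`, `censored_breatheFamily`).
[cite: Christodoulou1999, p. A24] -/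
theorem kerrEndedCensoredCurve_trivialData :
    ∃ (e : AFEnd Minkowski.slice) (F : EuclideanSpace ℝ (Fin 1) → InitialDataSet (𝓡 3) Minkowski.slice),
      InitialDataSet.IsTameDataFamily e 1 F ∧ InitialDataSet.IsImmersedAtZero 1 F ∧ Injective F ∧
        F 0 = trivialData ∧ (∀ c, F c ∈ admissibleVacuumData Minkowski.slice) ∧
          ∀ c, (F c).HasExactKerrEnd ∧
            ∀ 𝒟 : VacuumCauchyDevelopment (F c), 𝒟.IsMaximal →
              HasCompleteNullInfinity 𝒟.toCauchyDevelopment := by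
  have hd : trivialData ∈ admissibleVacuumData Minkowski.slice := trivialData_mem_admissibleVacuumData
  obtain ⟨-, e₀, M, hsole, hdecay⟩ := id hd
  set z₀ : E3 := (e₀.R + 3) • EuclideanSpace.single (0 : Fin 3) (1 : ℝ) with hz₀
  have hz₀n : ‖z₀‖ = e₀.R + 3 := by
    rw [hz₀, norm_smul, PiLp.norm_single, norm_one, mul_one,
      Real.norm_of_nonneg (by linarith [e₀.R_pos])]
  have B : e₀.BreathingData z₀ 1 := ⟨one_pos, by rw [hz₀n]; linarith⟩
  have hR₁ : e₀.R < e₀.R + 1 := by linarith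
  exact ⟨e₀.restrict hR₁.le, fun c ↦ AFEnd.breatheFamily B trivialData (c 0),
    AFEnd.isTameDataFamily_restrict_breatheCurve B trivialData hsole hdecay hR₁,
    AFEnd.isImmersedAtZero_breatheCurve B trivialData, AFEnd.injective_breatheCurve B trivialData,
    AFEnd.breatheCurve_zero B trivialData,
    fun c ↦ AFEnd.breatheCurve_mem_admissibleVacuumData B trivialData hd c,
    fun c ↦ ⟨hasExactKerrEnd_trivialData.breatheFamily B (c 0),
      censored_breatheFamily B trivialData (c 0) censored_trivialData⟩⟩

/-- **THE HYPOTHESES OF THE CRUX ARE MET AT THE TRIVIAL DATUM, NON-DEGENERATELY** (registered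
anti-vacuity stub; verbatim the let-bound vocabulary of the route file at `X = Minkowski.slice`):
there is a tame curve `F` of admissible data on an end of `ℝ³`, immersed at `0` and injective
(the non-constant alternative of the hypothesis), through the trivial datum, ALL of whose members are
Kerr-ended (`KerrEnded`, i.e. `HasExactKerrEnd` by `InitialDataSet.hasExactKerrEnd_iff`) and censored
(`Censored`) — `kerrEndedCensoredCurve_trivialData`. Hence the hypothesis blocks of
`SettlingAlongCensoredKerrEnds` and `CensorshipAlongKerrEnds` (and the conclusion of the latter) are
instantiated in the tree by a certified, non-constant curve. [cite: Christodoulou1999, p. A24] -/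
theorem hypothesesWitness_trivialData :
    let KerrEnded : Literature.Geometry.Lorentzian.InitialDataSet (𝓡 3) Literature.Geometry.Lorentzian.Minkowski.slice → Prop := fun D ↦ ∀ [Literature.Geometry.Lorentzian.Kerr.Facts], ∃ (K : Set Literature.Geometry.Lorentzian.Minkowski.slice) (U : Opens Literature.Geometry.Lorentzian.E3) (M a r₀ : ℝ) (hM : 0 ≤ M) (φ : U → Literature.Geometry.Lorentzian.Minkowski.slice) (ψ : U → Literature.Geometry.Lorentzian.Kerr.region a r₀) (ν : Literature.Geometry.Lorentzian.NormalField 𝓘(ℝ, Literature.Geometry.Lorentzian.E4) ψ), IsCompact K ∧ Kᶜ ⊆ range φ ∧ Topology.IsOpenEmbedding φ ∧ ContMDiff 𝓘(ℝ, Literature.Geometry.Lorentzian.E3) (𝓡 3) ((⊤ : ℕ∞) : WithTop ℕ∞) φ ∧ Injective ψ ∧ (Literature.Geometry.Lorentzian.Kerr.smoothMetric M a r₀).IsSpacelikeImmersion 𝓘(ℝ, Literature.Geometry.Lorentzian.E3) ψ ∧ (Literature.Geometry.Lorentzian.Kerr.smoothMetric M a r₀).IsFutureUnitNormal 𝓘(ℝ,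 Literature.Geometry.Lorentzian.E3) ((Literature.Geometry.Lorentzian.Kerr.timeOrientation M a r₀ hM).ofLE le_top) ψ ν ∧ (∀ (y : U) (v w : Literature.Geometry.Lorentzian.E3), φ y ∉ K → D.h.inner (φ y) (mfderiv 𝓘(ℝ, Literature.Geometry.Lorentzian.E3) (𝓡 3) φ y v) (mfderiv 𝓘(ℝ, Literature.Geometry.Lorentzian.E3) (𝓡 3) φ y w) = Literature.Geometry.Lorentzian.Kerr.bilin M a (ψ y : Literature.Geometry.Lorentzian.E4) (mfderiv 𝓘(ℝ, Literature.Geometry.Lorentzian.E3) 𝓘(ℝ, Literature.Geometry.Lorentzian.E4) ψ y v) (mfderiv 𝓘(ℝ, Literature.Geometry.Lorentzian.E3) 𝓘(ℝ, Literature.Geometry.Lorentzian.E4) ψ y w)) ∧ (∀ [(Literature.Geometry.Lorentzian.Kerr.smoothMetric M a r₀).HasLeviCivita] (y : U) (v w : Literature.Geometry.Lorentzian.E3), φ y ∉ K → D.k (φ y) (mfderiv 𝓘(ℝ, Literature.Geometry.Lorentzian.E3) (𝓡 3) φ y v) (mfderiv 𝓘(ℝ, Literature.Geometry.Lorentzian.E3)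 (𝓡 3) φ y w) = (Literature.Geometry.Lorentzian.Kerr.smoothMetric M a r₀).secondFundamentalForm 𝓘(ℝ, Literature.Geometry.Lorentzian.E3) ψ ν y v w); let Censored : Literature.Geometry.Lorentzian.InitialDataSet (𝓡 3) Literature.Geometry.Lorentzian.Minkowski.slice → Prop := fun D ↦ ∀ 𝒟 : Literature.Geometry.Lorentzian.VacuumCauchyDevelopment D, 𝒟.IsMaximal → Summit.FinalStateConjecture.HasCompleteNullInfinity 𝒟.toCauchyDevelopment;  ∃ (e : Literature.Geometry.Lorentzian.AFEnd Literature.Geometry.Lorentzian.Minkowski.slice) (F : EuclideanSpace ℝ (Fin 1) → Literature.Geometry.Lorentzian.InitialDataSet (𝓡 3) Literature.Geometry.Lorentzian.Minkowski.slice), Literature.Geometry.Lorentzian.InitialDataSet.IsTameDataFamily e 1 F ∧ (Literature.Geometry.Lorentzian.InitialDataSet.IsImmersedAtZero 1 F ∧ Injective F) ∧ F 0 = Literature.Geometry.Lorentzian.trivialData ∧ (∀ c, F c ∈ Literature.Geometry.Lorentzian.admissibleVacuumData Literature.Geometry.Lorentzian.Minkowski.slice) ∧ ∀ c, KerrEnded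 (F c) ∧ Censored (F c) := by
  intro KerrEnded Censored
  obtain ⟨e, F, hF, himm, hinj, h0, hadm, hKC⟩ := kerrEndedCensoredCurve_trivialData
  exact ⟨e, F, hF, ⟨himm, hinj⟩, h0, hadm, fun c ↦ ⟨(hKC c).1, (hKC c).2⟩⟩

end Summit.FinalStateConjecture.FinalStateConjecture.Theorems.ExactKerrEnds

end
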